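import Summits.BirchSwinnertonDyer.BirchSwinnertonDyer.Theorems.KolyvaginDepthDoorMSymbolCert718b1K
import Summits.BirchSwinnertonDyer.BirchSwinnertonDyer.Theorems.KolyvaginDepthDoorMSymbolCert817a1K
import HarnessLib

/-!
# Route `KolyvaginDepthDoor`, crux `KolyvaginDepthSupplyKN` (stmt-BirchSwinnertonDyer-22820) —
# DEPTH TABLE v29, DATA of `718b1`: piece 1/2 of the Kurihara sum at `(5, 10721)`

Helper file of the lead prover of line `levelone` (kdd-p1 g34; `--supports stmt-BirchSwinnertonDyer-22820 --as helper`);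
MACHINE-WRITTEN DATA + `decide` (generator `work/py/gen5lean.py`, tools of TOOLS-v28). Kernel evaluation of `∑_{6676 ≤ k < 10721} gE718 k` (181045 continued-fraction steps, three `decide` sub-chunks). It closes nothing and BSD is NOT proved by it.

References: [CremonaAlgorithms1997] §2.2–2.5, §2.8, Table 1 (718b1); [PopaZagier2017] §4 (13); [Kim2022StructureSelmer] §1.4.3;
[MazurTateTeitelbaum1986Invent] §I.8.
-/

set_option linter.dupNamespace false
-- the packed numerals are long literals
set_option linter.style.longLine false

noncomputable section

open scoped MatrixGroups ModularForm
open CongruenceSubgroup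
open Literature.NumberTheory.EllipticCurves Literature.NumberTheory.EllipticCurves.ModularForms
open Literature.NumberTheory.Automorphic.PopaZagier (coeff12 coeff12M coeff coeffN)
open Summit.BirchSwinnertonDyer.BirchSwinnertonDyer.Rank2Observatory
open Summit.BirchSwinnertonDyer.BirchSwinnertonDyer.Rank1Residual (IntModel.frobeniusTrace_eq IntModel.minimalDiscriminantInt_eq)
open Summit.BirchSwinnertonDyer.BirchSwinnertonDyer.Theorems.KolyvaginDepthDoor.MSymbolCert.Cert389a1
  (H3 H3fin support_subset_H3fin H3fin_det H3mat_nodup H3_det H3_coeff eval_map eval_append)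
open Summit.BirchSwinnertonDyer.BirchSwinnertonDyer.Theorems.KolyvaginDepthDoor.MSymbolCert.Level10721
open Summit.BirchSwinnertonDyer.BirchSwinnertonDyer.Theorems.KolyvaginDepthDoor.MSymbolCert.Cert817a1 (zmod5_range'_map_sum_split)

namespace Summit.BirchSwinnertonDyer.BirchSwinnertonDyer.Theorems.KolyvaginDepthDoor.MSymbolCert.Cert718b1

set_option maxHeartbeats 4000000 in
/-- **Piece 1 of the Kurihara sum of `718b1` at `(5, 10721)`**: `∑_{6676 ≤ k < 10721} gE718 k = 1` in `ZMod 5` (decide). [cite: Kim2022StructureSelmer, §1.4.3] -/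
theorem kSumPiece1 : ((List.range' 6676 4045).map gE718).sum = ((1 : ℕ) : ZMod 5) := by
  have h0 : ((List.range' 6676 2096).map gE718).sum = ((0 : ℕ) : ZMod 5) := by decide +kernel
  have h1 : ((List.range' (6676 + 2096) 1803).map gE718).sum = ((4 : ℕ) : ZMod 5) := by decide +kernel
  have h2 : ((List.range' (6676 + (2096 + 1803)) 146).map gE718).sum = ((2 : ℕ) : ZMod 5) := by decide +kernel
  have e := zmod5_range'_map_sum_split gE718 6676 (2096 + 1803) 146 _ _ (zmod5_range'_map_sum_split gE718 6676 2096 1803 _ _ h0 h1) h2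
  refine (show ((List.range' 6676 4045).map gE718).sum = ((List.range' 6676 (2096 + 1803 + 146)).map gE718).sum from rfl).trans
    (e.trans ?_)
  decide

end Summit.BirchSwinnertonDyer.BirchSwinnertonDyer.Theorems.KolyvaginDepthDoor.MSymbolCert.Cert718b1

end
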